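import Mathlib
import Literature.Analysis.FluidPDE.TypeIAncientMild
import Literature.Analysis.FluidPDE.TypeIAncientMildClassical
import Literature.Analysis.FluidPDE.CurlFreeLiouville
import Literature.Analysis.FluidPDE.VorticityCalculus
import Literature.Analysis.FluidPDE.SpaceTimeCalculus
import Literature.Analysis.FluidPDE.AxisymmetricVorticityTransport
import Literature.Analysis.FluidPDE.TsaiMaximumPrinciple
import Literature.Analysis.FluidPDE.LocalBiotSavartCalculus
import Literature.Analysis.PDE.PoissonBall
import Summits.NavierStokesRegularity.NavierStokesRegularity.Theorems.SymmetryModuliCountStretchingCertificateComparisonKato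
import HarnessLib

/-!
# Census row A1apT, in-row members A1sh / A1sep (instrument «MODE RANK») — LINE «mode-rank» port, part 1/4: generic lemmas —
# coordinates on finite-dimensional spaces of functions (§A1), linear damping beats a vanishing perturbation backward in time (§A2), comparison (§A3)

Re-homed for the scenario census (typer seat ns-census-typer-1 g8; the cells A1sh / A1sep are MEMBERS OF RECORD «DECIDED IN KERNEL IN FILES» of row
A1apT since census v1.71 (critic idea-crit-3 g6 PASS — no price 20:24:04Z; ref ns-census-ref g8 PRE-CHECK ✓ §13.14 item 9; lead-presearch label); this port
makes them TREE-decided): VERBATIM PORT of ns-idea-2 LINE g12-1 «mode-rank», `pub/ideators/ns-idea-2/lines/mode-rank/line-mode-rank.lean` sha16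
fb66c8a2d8442bee (1040 l., lean check rc 0, 0 sorry), split for the 400-line rule into `ScenarioCensusModeRank` (§A1–§A3) → `…ModeRankSpatial` (§A4, §B
instrument) → `…ModeRankShell` (§B decaying shell, `Row_A1sh`) → `…ModeRankRows` (§B separable row, head cell, census KEYS).  Lean text VERBATIM in namespace
`…Theorems.ScenarioCensus.ModeRank` (the line's `…Lines.ModeRank` re-homed); port edits: the two `local notation "E3"` lines (inside `section Spatial` /
`section Rows`) → one `abbrev E3` at namespace level and the bracket lines `section Rows` / `end Rows` dropped (no `variable`s in that section; typer lint: no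
notation in port files), `@[conjecture]` on the OPEN head cell `Row_A1rk` (typed only, no witness); the helper `abs_apply_le_norm` (`|z i| ≤ ‖z‖`, a verbatim twin of a landed
Literature lemma — gate lint `dedup.landed`) is not re-declared and its single use in `curl_eq_zero_of_negShell` is Mathlib's `PiLp.norm_apply_le` (proof text
only).  Statements untouched.

No census VALUE is moved here (row A1apT keeps its value; the members become TREE-decided by name); NS regularity is NOT proved; (L′)
`TypeIAncientLiouville` ⟨10661⟩ is untouched; no summit statement is proved by this file.
-/

-- the summit and its single problem share the name `NavierStokesRegularity` (D-0017 nested layout)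
set_option linter.dupNamespace false

noncomputable section

open Set Function Filter Topology

namespace Summit.NavierStokesRegularity.NavierStokesRegularity.Theorems.ScenarioCensus.ModeRank

open Literature.Analysis Literature.Analysis.FluidPDE InnerProductSpace
open Summit.NavierStokesRegularity.NavierStokesRegularity.Theorems (vorticity_eq_deriv_of_typeI)
open scoped Laplacian InnerProductSpace RealInnerProductSpace ContDiff

/-- `ℝ³` (the line's `local notation "E3"`, spelled as a reducible abbreviation for the tree). -/
abbrev E3 := EuclideanSpace ℝ (Fin 3)

/-! ## A. Generic lemmas -/
/-! ### A1. Linear functionals on finite-dimensional spaces of functions are continuous for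
pointwise convergence; pointwise derivatives pass through them. -/

section Coordinates

variable {X V : Type*} [NormedAddCommGroup V] [NormedSpace ℝ V]
variable {G : Type*} [NormedAddCommGroup G] [NormedSpace ℝ G]

/-- Pointwise convergence of a net in a submodule of `X → V` is convergence in the submodule
(subspace-of-product topology). -/
theorem tendsto_submodule_iff {W : Submodule ℝ (X → V)} {α : Type*} {l : Filter α}
    {f : α → W} {z : W} :
    Tendsto f l (𝓝 z) ↔ ∀ x, Tendsto (fun a => (f a : X → V) x) l (𝓝 ((z : X → V) x)) := by
  rw [tendsto_subtype_rng, tendsto_pi_nhds]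

/-- A linear map out of a finite-dimensional submodule of `X → V` (pointwise topology) into a normed
space is continuous. -/
theorem continuous_linearMap_submodule {W : Submodule ℝ (X → V)} [FiniteDimensional ℝ W]
    (ℓ : W →ₗ[ℝ] G) : Continuous ℓ :=
  LinearMap.continuous_of_finiteDimensional ℓ

/-- Limits pass through linear maps on finite-dimensional function spaces, pointwise hypotheses. -/
theorem tendsto_linearMap_of_pointwise {W : Submodule ℝ (X → V)} [FiniteDimensional ℝ W]
    (ℓ : W →ₗ[ℝ] G) {α : Type*} {l : Filter α} {f : α → W} {z : W}
    (h : ∀ x, Tendsto (fun a => (f a : X → V) x) l (𝓝 ((z : X → V) x))) :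
    Tendsto (fun a => ℓ (f a)) l (𝓝 (ℓ z)) :=
  ((continuous_linearMap_submodule ℓ).tendsto z).comp (tendsto_submodule_iff.2 h)

/-- Derivatives pass through linear maps on finite-dimensional function spaces: if every time line
`s ↦ Ω s x` has derivative `Ω' x` at `t`, then `s ↦ ℓ (Ω s)` has derivative `ℓ Ω'` at `t`. -/
theorem hasDerivAt_linearMap_of_pointwise {W : Submodule ℝ (X → V)} [FiniteDimensional ℝ W]
    (ℓ : W →ₗ[ℝ] G) {Ω : ℝ → W} {Ω' : W} {t : ℝ}
    (h : ∀ x, HasDerivAt (fun s => (Ω s : X → V) x) ((Ω' : X → V) x) t) :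
    HasDerivAt (fun s => ℓ (Ω s)) (ℓ Ω') t := by
  rw [hasDerivAt_iff_tendsto_slope]
  have hs : ∀ s, slope (fun s => ℓ (Ω s)) t s = ℓ (slope Ω t s) := by
    intro s
    rw [slope_def_module, slope_def_module, map_smul, map_sub]
  rw [show slope (fun s => ℓ (Ω s)) t = fun s => ℓ (slope Ω t s) from funext hs]
  refine tendsto_linearMap_of_pointwise ℓ fun x => ?_
  have hx := (h x)
  rw [hasDerivAt_iff_tendsto_slope] at hx
  refine hx.congr' (Eventually.of_forall fun s => ?_)
  show slope (fun s => (Ω s : X → V) x) t s = ((slope Ω t s : W) : X → V) x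
  rw [slope_def_module, slope_def_module, Submodule.coe_smul, Submodule.coe_sub, Pi.smul_apply,
    Pi.sub_apply]

/-- Continuity version. -/
theorem continuousAt_linearMap_of_pointwise {W : Submodule ℝ (X → V)} [FiniteDimensional ℝ W]
    (ℓ : W →ₗ[ℝ] G) {Ω : ℝ → W} {t : ℝ}
    (h : ∀ x, ContinuousAt (fun s => (Ω s : X → V) x) t) :
    ContinuousAt (fun s => ℓ (Ω s)) t :=
  tendsto_linearMap_of_pointwise ℓ (z := Ω t) fun x => h x

end Coordinates

/-! ### A2. Linear damping beats a vanishing perturbation backward in time. -/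

section Damping

variable {G : Type*} [NormedAddCommGroup G] [InnerProductSpace ℝ G]

open RealInnerProductSpace in
/-- **Backward–forward Liouville lemma for a damped linear ODE with small linear forcing.**
If `c' = μ c - g` on `t < 0` with `μ < 0`, `‖g(t)‖ ≤ ε(t)‖c(t)‖`, `ε` continuous on `t < 0` with
`ε(t) → 0` and `‖c(t)‖ → 0` as `t → -∞`, then `c ≡ 0` on `t < 0`. -/
theorem eq_zero_of_damped {c g : ℝ → G} {μ : ℝ} (hμ : μ < 0) {ε : ℝ → ℝ}
    (hc : ∀ t < 0, HasDerivAt c (μ • c t - g t) t)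
    (hg : ∀ t < 0, ‖g t‖ ≤ ε t * ‖c t‖)
    (hεc : ContinuousOn ε (Iio 0)) (hε : Tendsto ε atBot (𝓝 0))
    (hc0 : Tendsto (fun t => ‖c t‖) atBot (𝓝 0)) :
    ∀ t < 0, c t = 0 := by
  -- Step 1: far in the past the forcing is dominated: `ε ≤ -μ/2` on `(-∞, T₀]`, `T₀ < 0`.
  obtain ⟨T₀, hT₀, hεT⟩ : ∃ T₀ < (0 : ℝ), ∀ t ≤ T₀, ε t ≤ -μ / 2 := by
    have hev : ∀ᶠ t in atBot, ε t < -μ / 2 := hε.eventually (gt_mem_nhds (by linarith))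
    obtain ⟨T, hT⟩ := eventually_atBot.1 hev
    exact ⟨min T (-1), by
      exact lt_of_le_of_lt (min_le_right _ _) (by norm_num), fun t ht =>
      (hT t (ht.trans (min_le_left _ _))).le⟩
  -- the energy `E = ‖c‖²` and its derivative
  set E : ℝ → ℝ := fun t => ‖c t‖ ^ 2 with hE
  have hEd : ∀ t < 0, HasDerivAt E (2 * ⟪c t, μ • c t - g t⟫) t := fun t ht => (hc t ht).norm_sq
  have hE'le : ∀ t < 0, 2 * ⟪c t, μ • c t - g t⟫ ≤ (2 * μ + 2 * ε t) * E t := by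
    intro t ht
    have h1 : ⟪c t, μ • c t - g t⟫ = μ * ‖c t‖ ^ 2 - ⟪c t, g t⟫ := by
      rw [inner_sub_right, real_inner_smul_right, real_inner_self_eq_norm_sq]
    have h2 : |⟪c t, g t⟫| ≤ ‖c t‖ * ‖g t‖ := abs_real_inner_le_norm _ _
    have h3 : ‖c t‖ * ‖g t‖ ≤ ε t * ‖c t‖ ^ 2 := by
      calc ‖c t‖ * ‖g t‖ ≤ ‖c t‖ * (ε t * ‖c t‖) :=
            mul_le_mul_of_nonneg_left (hg t ht) (norm_nonneg _)
        _ = ε t * ‖c t‖ ^ 2 := by ring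
    have h4 : -⟪c t, g t⟫ ≤ ε t * ‖c t‖ ^ 2 := by
      linarith [neg_abs_le ⟪c t, g t⟫]
    simp only [hE]
    rw [h1]; nlinarith
  -- Step 2: on `(-∞, T₀]`, `E' ≤ μ E`, so `F = exp(-μ t) E` is antitone there.
  have hc_cont : ∀ t < 0, ContinuousAt c t := fun t ht => (hc t ht).continuousAt
  have hE_cont : ContinuousOn E (Iio 0) := fun t ht =>
    ((hc_cont t ht).norm.pow 2).continuousWithinAt
  set F : ℝ → ℝ := fun t => Real.exp (-μ * t) * E t with hF
  have hFanti : AntitoneOn F (Iic T₀) := by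
    have hconv : Convex ℝ (Iic T₀) := convex_Iic T₀
    have hint : interior (Iic T₀) = Iio T₀ := interior_Iic
    refine antitoneOn_of_hasDerivWithinAt_nonpos hconv ?_ ?_ ?_ (f' := fun t =>
      Real.exp (-μ * t) * (2 * ⟪c t, μ • c t - g t⟫ - μ * E t))
    · intro t ht
      have ht0 : t < 0 := lt_of_le_of_lt ht hT₀
      exact ((Real.continuous_exp.comp (continuous_const.mul continuous_id)).continuousAt.mul
        ((hc_cont t ht0).norm.pow 2)).continuousWithinAt
    · intro t ht
      rw [hint] at ht ⊢
      have ht0 : t < 0 := ht.trans hT₀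
      have hexp : HasDerivAt (fun s => Real.exp (-μ * s)) (Real.exp (-μ * t) * (-μ)) t := by
        have h := ((hasDerivAt_id t).const_mul (-μ)).exp
        simp only [id, mul_one] at h
        exact h
      have hprod := hexp.mul (hEd t ht0)
      have : Real.exp (-μ * t) * (-μ) * E t + Real.exp (-μ * t) * (2 * ⟪c t, μ • c t - g t⟫) =
          Real.exp (-μ * t) * (2 * ⟪c t, μ • c t - g t⟫ - μ * E t) := by ring
      rw [this] at hprod
      exact hprod.hasDerivWithinAt
    · intro t ht
      rw [hint] at ht
      have ht0 : t < 0 := ht.trans hT₀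
      have hle := hE'le t ht0
      have hεt := hεT t ht.le
      have hEnn : 0 ≤ E t := by positivity
      have : 2 * ⟪c t, μ • c t - g t⟫ - μ * E t ≤ 0 := by nlinarith
      exact mul_nonpos_iff.2 (Or.inl ⟨(Real.exp_pos _).le, this⟩)
  -- Step 3: `E t = 0` for `t ≤ T₀`: otherwise `E s ≥ E t > 0` for all `s ≤ t`, against `E → 0`.
  have hpast : ∀ t ≤ T₀, c t = 0 := by
    intro t ht
    by_contra hne
    have hEt : 0 < E t := by positivity
    have hlow : ∀ s ≤ t, E t ≤ E s := by
      intro s hs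
      have hFs := hFanti (hs.trans ht) ht hs
      -- `F t ≤ F s`, and `exp(-μ t) ≥ exp(-μ s)` since `-μ > 0`, `s ≤ t`
      have hexp : Real.exp (-μ * s) ≤ Real.exp (-μ * t) :=
        Real.exp_le_exp.2 (by nlinarith)
      have hEs : 0 ≤ E s := by positivity
      by_contra hlt
      push Not at hlt
      have : F s < F t := by
        calc F s = Real.exp (-μ * s) * E s := rfl
          _ ≤ Real.exp (-μ * t) * E s := mul_le_mul_of_nonneg_right hexp hEs
          _ < Real.exp (-μ * t) * E t := mul_lt_mul_of_pos_left hlt (Real.exp_pos _)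
          _ = F t := rfl
      linarith
    have hev : ∀ᶠ s in atBot, ‖c s‖ ^ 2 < E t := by
      have h2 : Tendsto (fun s => ‖c s‖ ^ 2) atBot (𝓝 0) := by
        simpa using hc0.pow 2
      exact h2.eventually (gt_mem_nhds hEt)
    obtain ⟨S, hS⟩ := eventually_atBot.1 hev
    have h1 := hS (min S t) (min_le_left _ _)
    have h2 := hlow (min S t) (min_le_right _ _)
    exact absurd h1 (not_lt.2 h2)
  -- Step 4: forward Gronwall from `T₀` with zero datum.
  intro t ht
  rcases le_or_gt t T₀ with hle | hgt
  · exact hpast t hle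
  · -- work on `[T₀, t]`
    obtain ⟨K, hK⟩ : ∃ K, ∀ s ∈ Icc T₀ t, |ε s| ≤ K := by
      have hcpt : IsCompact (Icc T₀ t) := isCompact_Icc
      have hcont : ContinuousOn (fun s => |ε s|) (Icc T₀ t) :=
        (continuous_abs.comp_continuousOn (hεc.mono fun s hs => lt_of_le_of_lt hs.2 ht))
      obtain ⟨K, hK⟩ := hcpt.bddAbove_image hcont
      exact ⟨K, fun s hs => hK (mem_image_of_mem _ hs)⟩
    have hbound := norm_le_gronwallBound_of_norm_deriv_right_le (f := c)
      (f' := fun s => μ • c s - g s) (δ := 0) (K := |μ| + K) (ε := 0) (a := T₀) (b := t)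
      (fun s hs => (hc_cont s (lt_of_le_of_lt hs.2 ht)).continuousWithinAt)
      (fun s hs => (hc s (hs.2.trans ht)).hasDerivWithinAt)
      (by rw [hpast T₀ le_rfl, norm_zero])
      (by
        intro s hs
        have hs0 : s < 0 := hs.2.trans ht
        calc ‖μ • c s - g s‖ ≤ ‖μ • c s‖ + ‖g s‖ := norm_sub_le _ _
          _ ≤ |μ| * ‖c s‖ + ε s * ‖c s‖ := by
              rw [norm_smul, Real.norm_eq_abs]; exact add_le_add le_rfl (hg s hs0)
          _ ≤ |μ| * ‖c s‖ + K * ‖c s‖ := by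
              have := hK s (Ico_subset_Icc_self hs)
              nlinarith [le_abs_self (ε s), norm_nonneg (c s)]
          _ = (|μ| + K) * ‖c s‖ + 0 := by ring)
      t (right_mem_Icc.2 hgt.le)
    rw [gronwallBound_ε0_δ0] at hbound
    exact norm_le_zero_iff.1 hbound

end Damping

/-! ### A3. Two linear maps on a finite-dimensional space bound each other. -/

section Comparison

/-- If `f` is an injective linear map on a finite-dimensional space, any linear map `g` into a
normed space is bounded by a multiple of `‖f ·‖`. -/
theorem exists_norm_le_mul_norm_of_injective {M : Type*} [AddCommGroup M] [Module ℝ M]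
    [FiniteDimensional ℝ M] {G₁ G₂ : Type*} [NormedAddCommGroup G₁] [NormedSpace ℝ G₁]
    [NormedAddCommGroup G₂] [NormedSpace ℝ G₂] (f : M →ₗ[ℝ] G₁) (hf : Function.Injective f)
    (g : M →ₗ[ℝ] G₂) : ∃ K, 0 ≤ K ∧ ∀ y, ‖g y‖ ≤ K * ‖f y‖ := by
  let e := LinearEquiv.ofInjective f hf
  let h : LinearMap.range f →ₗ[ℝ] G₂ := g ∘ₗ e.symm.toLinearMap
  let hL := LinearMap.toContinuousLinearMap h
  refine ⟨‖hL‖, norm_nonneg hL, fun y => ?_⟩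
  have h1 : g y = hL (e y) := by
    simp [hL, h]
  have h2 : ‖(e y : G₁)‖ = ‖f y‖ := by
    rw [LinearEquiv.ofInjective_apply]
  rw [h1]
  calc ‖hL (e y)‖ ≤ ‖hL‖ * ‖e y‖ := hL.le_opNorm _
    _ = ‖hL‖ * ‖f y‖ := by rw [← h2]; rfl

-- `abs_apply_le_norm`: the line's coordinate bound `|z i| ≤ ‖z‖` restates a landed Literature lemma (gate lint dedup.landed, twin `Literature.Algebra.EuclideanLattices.SimApproxLLL.abs_apply_le_norm'`); not re-declared — its one use below is Mathlib's `PiLp.norm_apply_le` (port edit, proof text only).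

end Comparison

end Summit.NavierStokesRegularity.NavierStokesRegularity.Theorems.ScenarioCensus.ModeRank

end
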